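import Mathlib.Data.Nat.Factorial.DoubleFactorial
import Literature.AlgebraicGeometry.Hyperkaehler.K3HilbertSchemeBeauville
import Literature.AlgebraicGeometry.Surfaces.PolarisedK3TwinKuranishiFamily
import Literature.AlgebraicGeometry.HodgeTheory.ChernCharacterBetti
import HarnessLib

/-!
# The Beauville–Fujiki package of `S^{[n]}` for a projective K3 surface `S`, with its incidence
# links to `S`, and the deformation equivalence of all `S^{[n]}` — NAMED FACTS

Layer `Literature/AlgebraicGeometry/Hyperkaehler`. Written for crux stmt-HodgeConjecture-14393
(`NikulinTwinTransport.TwinTwistorTransport`, line `mukai-lift-full-similitude`, stub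
`HilbertPackage`), to record — against the tree's EXISTING predicates
`ModuliOfSheaves.IsHilbertSchemeOfPoints n S H Ξ` ("`(H, Ξ)` is `S^{[n]}` with its universal
family", Göttsche Def. 1.1.3), `Surfaces.IsMarkedK3 S η p x` (marked projective K3 surface),
`HodgeTheory.complexGysin` (Gysin morphisms for an orientation family `μ`),
`HodgeTheory.algebraicClasses`, `HodgeTheory.cupPowTwo` and `Hyperkaehler.AreDeformationEquivalent` —
the two published packages about the Hilbert scheme of `n ≥ 2` points `H = S^{[n]}` of a projective
K3 surface `S` that every Mukai-lift / Markman-type transport between `S^{[n]}`'s starts from, and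
which the companion file `K3HilbertSchemeBeauville` (existence, Théorème 3, `b₂ = 23`) lists under
"Not here". No new definition; two named facts (D-0014), no proof.

* `Beauville1983_hilbertScheme_K3_markedLinks` — ONE composite fact, for `n ≥ 2`, a marked
  projective K3 `(S, η, p, x)`, its Hilbert scheme `(H, Ξ) = (S^{[n]}, Ξ_n)` and a proof `hH` that
  `H` is smooth projective of dimension `2n` (Fogarty/Grothendieck, `Beauville1983_hilbertScheme_K3`):
  there are a marking `θ : H²(H(ℂ); ℂ) ≅ Λ_ℂ ⊕ ℂδ` and a top class `pX ∈ H^{4n}(H(ℂ); ℂ)` with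
  (1) `pX` the integral generator of `H^{4n}`; (2) the integral classes of `H²` are
  `θ⁻¹(Λ ⊕ ℤδ)` (Beauville §6 Prop. 6 and Remarque: `H²(S^{[n]}, ℤ) = i(H²(S, ℤ)) ⊕ ℤδ`, `2δ = [E]`,
  with `θ(i(a) + tδ) = (η a, t)`); (3) the FUJIKI RELATION `a^{2n} = c_H · q(θ a)^n · pX` with the
  Beauville–Bogomolov form `q(u, t) = (u.u) − 2(n−1)t²` (§9 Lemme 1 and Remarque 1: `q(i(α)) = α²`,
  `q(δ) = −2(n−1)`, `δ ⟂ i(H²(S))`; Huybrechts 1999 §1.11, Fujiki 1987) and Fujiki constant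
  `c_H = (2n)!/(n! 2ⁿ) = (2n−1)!!` (Rapagnetta 2008, table of the Introduction and Thm. 3.0.9);
  (4)–(5) `θ⁻¹(x, 0) = i(η⁻¹ x)` spans the `(2,0)`-classes (Prop. 6:
  `i` is injective and compatible with Hodge structures, `h^{2,0}(S^{[n]}) = h^{2,0}(S) = 1`);
  (6) `δ = θ⁻¹(0, 1)` is algebraic (`2δ = [E]`, `E` the exceptional divisor); (7) the `δ`-coordinate
  is cup product with the algebraic class `ζ = δ^{2n−1} / ∫δ^{2n}` (polarised Fujiki relation,
  Rapagnetta Rem. 3.0.10: `∫ i(a) δ^{2n−1} = 0`, `∫ δ^{2n} = (2n−1)!!·(2−2n)ⁿ ≠ 0`); and, for EVERY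
  orientation family `μ` with Poincaré duality, (8a) Beauville's `i` is the action
  `[ι]_* = pr_{H*}(pr_S^* – ∪ ι)` on `H²` of an algebraic class `ι` on `H × S` (the transposed
  universal family `[Ξ_nᵗ]`, up to the unit by which `μ` differs from the complex orientations):
  `θ([ι]_* a) = (η a, 0)`; (8b) the transposed polarised link: an algebraic `ρ` on `S × H`
  (`[Ξ_n] ∪ pr_H^* δ^{2n−2}`) acts by `η([ρ]_* b) = c · (θ b)₁` with `c ≠ 0`
  (`∫ i(a) i(b) δ^{2n−2} = (2n−3)!!·(2−2n)^{n−1}·(a.b) ≠ 0` and `∫ i(a) δ^{2n−1} = 0`; correspondences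
  and their transposes, Fulton §16.1).
* `Beauville1983_hilbertScheme_K3_deformationEquivalent` — for `n ≥ 2`, the Hilbert schemes of `n`
  points of any two projective K3 surfaces are deformation equivalent `2n`-folds (Beauville §9,
  p. 778: for a family of K3 surfaces over a smooth base the relative Douady space of `n` points is
  smooth over the base; any two K3 surfaces are deformation equivalent, Kodaira — Huybrechts, K3
  book, Ch. 7 Thm. 1.1; Huybrechts 1999 §2.2).

Design. (a) ONE composite fact for (1)–(8): the links (8a), (8b) and the clauses (6), (7) are
stated against the SAME marking `θ` and top class `pX` as the Fujiki relation, and `θ`, `pX` are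
chosen BEFORE the orientation family `μ` (only `ι`, `ρ`, `c` depend on `μ`), which separate facts
could not express without naming `θ`. (b) The action of a correspondence is written inline as
`complexGysin μ (tensor_holds hA hB) hA fst _ (snd^* y ∪ γ)` (Voisin II (10.7), Fulton Def. 16.1.2),
literally the summit-side abbreviation it serves, so that consumers match it definitionally.
(c) Relation to `Beauville1983_hilbertSquare_markedIncidence` (file `K3HilbertSquareIncidence`, the
`n = 2` incidence clause (8a) alone, with `H` chosen AFTER `μ` and against
`HilbertScheme.IsHilbertSchemeOfPoints` / `IsOfK3HilbertSquareType`): the present fact is for all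
`n ≥ 2`, for a GIVEN Hilbert scheme `(H, Ξ)` in the sense of `ModuliOfSheaves.IsHilbertSchemeOfPoints`,
quantifies `θ`, `pX` before `μ`, and adds the transposed/polarised links `ρ`, `ζ` and "`δ`
algebraic"; neither statement is a restatement of the other.
TODO(general form): Beauville proves Prop. 6, Théorème 3 and §9 for every Kähler K3 surface and every
`n ≥ 1` via the Douady space; stated here for `S` projective (the tree's `IsK3Surface`) and `n ≥ 2`.

What is NOT here: existence of `(H, Ξ)` and Théorème 3 (`K3HilbertSchemeBeauville`); the value of the
unit relating `μ` to the complex orientations; `n = 1` (`S^{[1]} = S`); generalized Kummer varieties;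
any proof.

Sources READ (held texts, 2026-08-16): Beauville 1983 §6 pp. 765–768 (propriétés (a)–(f), Prop. 5,
Lemme 1, Lemme 2, Prop. 6 + Remarque, Théorème 3), §8 Théorème 5, §9 pp. 777–779 (Lemme 1, Remarque 1,
relative Douady space, Lemme 2, Prop. 10, Théorème 6); Huybrechts 1999 (arXiv alg-geom/9705025) §1.11
(Fujiki relation `∫β^{2n} = c·q_X(β)ⁿ`), §2.2 (`Hilbⁿ(S)`, `H² ≅ H²(S, ℤ) ⊕ (−2(n−1))`); Rapagnetta,
Math. Ann. 340 (2008) Introduction (table: `c_{X^{[n]}} = (2n)!/(n!2ⁿ)`), Thm. 3.0.9, Rem. 3.0.10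
(polarised form); Huybrechts, Lectures on K3 Surfaces, Ch. 7 Def. 1.1 and Thm. 1.1.
-/

noncomputable section

open CategoryTheory MonoidalCategory
open Literature.AlgebraicTopology.SingularHomology

namespace Literature.AlgebraicGeometry.Hyperkaehler

/-- **Beauville 1983 §6 and §9 with Fujiki's relation and the incidence links, for the Hilbert
scheme of `n ≥ 2` points of a marked projective K3 surface.** Let `(S, η, p, x)` be a marked
projective K3 surface (`Surfaces.IsMarkedK3`), `n ≥ 2`, `(H, Ξ) = (S^{[n]}, Ξ_n)` its Hilbert scheme of
`n` points with universal family (`ModuliOfSheaves.IsHilbertSchemeOfPoints`) and `hH` a proof that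
`H` is smooth projective of dimension `2n`. Then there are `θ : H²(H(ℂ); ℂ) ≃ Λ_ℂ ⊕ ℂ` (the marking
`i(a) + tδ ↦ (η a, t)`; Prop. 6: "il existe un homomorphisme injectif `i : H²(S, ℂ) → H²(S^{[r]}, ℂ)`,
compatible aux structures de Hodge, et on a `H²(S^{[r]}, ℂ) = i(H²(S, ℂ)) ⊕ ℂ[E]`", Remarque:
"`H²(S^{[r]}, ℤ) = i(H²(S, ℤ)) ⊕ ℤδ`, où `2δ = [E]`") and `pX ∈ H^{4n}(H(ℂ); ℂ)` such that: `pX` is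
integral and generates the integral classes of `H^{4n}`; the integral classes of `H²` are
`θ⁻¹(ℤ²² ⊕ ℤ)`; the Fujiki relation `a^{2n} = (2n−1)!! · q_n(θ a)ⁿ · pX` holds with
`q_n(u, t) = (u.u) − (2n−2)t²` (§9 Lemme 1, Remarque 1: "Normalisons `q` de façon que `q(i(α)) = α²`;
on peut alors montrer qu'on a `q(e) = −8(r−1)`", `e = 2δ`, `e ⟂ i(H²(S))`; Fujiki constant
`(2n)!/(n!2ⁿ)`); `θ⁻¹(x, 0)` is of type `(2,0)` and spans the `(2,0)`-classes (`h^{2,0}(S^{[r]}) =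
h^{2,0}(S) = 1`); `δ = θ⁻¹(0, 1)` is an algebraic class of codimension `1`; for some algebraic `ζ` of
codimension `m = 2n−1` (`ζ = δ^{2n−1}/∫δ^{2n}`, `∫δ^{2n} = (2n−1)!!(2−2n)ⁿ ≠ 0`, `∫ i(a)δ^{2n−1} = 0`)
one has `b ∪ ζ = (θ b)₂ · pX`; and for every orientation family `μ` with Poincaré duality there are
an algebraic `ι` on `H × S` of codimension `2` (the transposed universal family, up to a unit) with
`θ(pr_{H*}(pr_S^* a ∪ ι)) = (η a, 0)` — Beauville's `i` is the incidence correspondence — and an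
algebraic `ρ` on `S × H` of codimension `2n` (`[Ξ_n] ∪ pr_H^* δ^{2n−2}`) and `c ≠ 0`
(`∝ (2n−3)!!(2−2n)^{n−1}`) with `η(pr_{S*}(pr_H^* b ∪ ρ)) = c · (θ b)₁`.
TODO(general form): Beauville proves this for every Kähler K3 surface and every `n ≥ 1` (Douady space).
[cite: Beauville1983, §6 Prop. 6 and Remarque, Théorème 3, §9 Lemme 1 and Remarque 1]
[cite: Huybrechts1999, §1.11 (Fujiki relation) and §2.2]
[cite: Rapagnetta2007, Introduction (table) and Thm. 3.0.9, Rem. 3.0.10]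
[cite: Fulton1998, §16.1 Def. 16.1.2] -/
def Beauville1983_hilbertScheme_K3_markedLinks : Prop :=
  ∀ n : ℕ, 2 ≤ n → ∀ (S : Motives.SchemeOver ℂ) (hS : Surfaces.IsK3Surface S)
    (η : HodgeTheory.complexBetti S (2 * 1) ≃ₗ[ℂ] (Surfaces.K3Index → ℂ))
    (p : HodgeTheory.complexBetti S (2 * 2)) (x : Surfaces.K3Index → ℂ),
    Surfaces.IsMarkedK3 S η p x →
    ∀ (H : Motives.SchemeOver ℂ) (Ξ : (S ⊗ H).left.IdealSheafData),
      ModuliOfSheaves.IsHilbertSchemeOfPoints n S H Ξ →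
    ∀ (hH : Motives.IsSmoothProjective (2 * n) H),
    ∃ (θ : HodgeTheory.complexBetti H (2 * 1) ≃ₗ[ℂ] ((Surfaces.K3Index → ℂ) × ℂ))
      (pX : HodgeTheory.complexBetti H (2 * (2 * n))),
      (HodgeTheory.IsIntegralClass pX ∧
          ∀ q : HodgeTheory.complexBetti H (2 * (2 * n)),
            HodgeTheory.IsIntegralClass q → ∃ k : ℤ, q = k • pX) ∧
      (∀ c : HodgeTheory.complexBetti H (2 * 1),
          HodgeTheory.IsIntegralClass c ↔
            ∃ (v : Surfaces.K3Index → ℤ) (k : ℤ), θ c = (fun i => (v i : ℂ), (k : ℂ))) ∧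
      (∀ a : HodgeTheory.complexBetti H (2 * 1),
          HodgeTheory.cupPowTwo a (2 * n) =
            ((Nat.doubleFactorial (2 * n - 1) : ℂ) *
                (Surfaces.k3Form (θ a).1 (θ a).1 - (2 * (n : ℂ) - 2) * ((θ a).2 * (θ a).2)) ^ n) •
              pX) ∧
      HodgeTheory.IsOfHodgeType (2 * n) H (2 * 1) 2 0 (θ.symm (x, 0)) ∧
      (∀ τ : HodgeTheory.complexBetti H (2 * 1),
          HodgeTheory.IsOfHodgeType (2 * n) H (2 * 1) 2 0 τ → ∃ t : ℂ, τ = t • θ.symm (x, 0)) ∧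
      θ.symm (0, 1) ∈ HodgeTheory.algebraicClasses H 1 ∧
      (∃ (m : ℕ) (hm : 2 * 1 + 2 * m = 2 * (2 * n)) (ζ : HodgeTheory.complexBetti H (2 * m)),
          ζ ∈ HodgeTheory.algebraicClasses H m ∧
            ∀ b : HodgeTheory.complexBetti H (2 * 1), cupProduct hm b ζ = (θ b).2 • pX) ∧
      ∀ (μ : HodgeTheory.OrientationFamily), μ.HasPoincareDuality →
        (∃ ι ∈ HodgeTheory.algebraicClasses (H ⊗ S) 2,
            ∀ a : HodgeTheory.complexBetti S (2 * 1),
              θ (HodgeTheory.complexGysin μ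
                  (Motives.IsSmoothProjective.tensor_holds hH
                    (Surfaces.IsK3Surface.isSmoothProjective hS))
                  hH (SemiCartesianMonoidalCategory.fst H S)
                  (show 2 * 1 + 2 * 2 + 2 * (2 * n) = 2 * 1 + 2 * (2 * n + 2) by ring)
                  (cupProduct (rfl : 2 * 1 + 2 * 2 = 2 * 1 + 2 * 2)
                    (HodgeTheory.complexBetti.map (SemiCartesianMonoidalCategory.snd H S) (2 * 1) a)
                    ι)) =
                (η a, 0)) ∧
        (∃ ρ ∈ HodgeTheory.algebraicClasses (S ⊗ H) (2 * n), ∃ c : ℂ, c ≠ 0 ∧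
            ∀ b : HodgeTheory.complexBetti H (2 * 1),
              η (HodgeTheory.complexGysin μ
                  (Motives.IsSmoothProjective.tensor_holds
                    (Surfaces.IsK3Surface.isSmoothProjective hS) hH)
                  (Surfaces.IsK3Surface.isSmoothProjective hS)
                  (SemiCartesianMonoidalCategory.fst S H)
                  (show 2 * 1 + 2 * (2 * n) + 2 * 2 = 2 * 1 + 2 * (2 + 2 * n) by ring)
                  (cupProduct (rfl : 2 * 1 + 2 * (2 * n) = 2 * 1 + 2 * (2 * n))
                    (HodgeTheory.complexBetti.map (SemiCartesianMonoidalCategory.snd S H) (2 * 1) b)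
                    ρ)) =
                c • (θ b).1)

/-- **The Hilbert schemes of `n` points of projective K3 surfaces form one deformation class**
(`n ≥ 2`). Beauville 1983 §9 (p. 778): "Soient `B` une variété lisse, `0` un point de `B`, et soit
`𝒮 → B` une famille de surfaces K3. Les variétés `𝒮_s^{[r]}`, pour `s ∈ B`, s'organisent en un espace
de Douady relatif `𝒳`, lisse au-dessus de `B`" — so `S ↦ S^{[n]}` carries deformations of K3
surfaces (proper holomorphic submersions over connected bases) to deformations of their Hilbert
schemes — and any two complex K3 surfaces are deformation equivalent (Kodaira; Huybrechts, K3 book,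
Ch. 7 Thm. 1.1: "Any two complex K3 surfaces are deformation equivalent"). Rendering: for projective
K3 surfaces `S`, `S₀` (`Surfaces.IsK3Surface`) and their Hilbert schemes `(H, Ξ)`, `(H₀, Ξ₀)` of `n`
points (`ModuliOfSheaves.IsHilbertSchemeOfPoints`), `H` and `H₀` are deformation equivalent smooth
`2n`-folds (`AreDeformationEquivalent (2 * n) H H₀`: chains of proper holomorphic submersions over
connected bases between analytifications). TODO(general form): every Kähler K3 and every `n ≥ 1`.
[cite: Beauville1983, §9 (espace de Douady relatif, p. 778) and Théorème 6]
[cite: Huybrechts2016K3, Ch. 7 Def. 1.1 and Thm. 1.1] [cite: Huybrechts1999, §2.2 and §2.4] -/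
def Beauville1983_hilbertScheme_K3_deformationEquivalent : Prop :=
  ∀ (n : ℕ), 2 ≤ n → ∀ (S S₀ H H₀ : Motives.SchemeOver ℂ) (Ξ : (S ⊗ H).left.IdealSheafData)
    (Ξ₀ : (S₀ ⊗ H₀).left.IdealSheafData), Surfaces.IsK3Surface S → Surfaces.IsK3Surface S₀ →
    ModuliOfSheaves.IsHilbertSchemeOfPoints n S H Ξ →
    ModuliOfSheaves.IsHilbertSchemeOfPoints n S₀ H₀ Ξ₀ →
    AreDeformationEquivalent (2 * n) H H₀

end Literature.AlgebraicGeometry.Hyperkaehler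

end
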